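import Summits.BirchSwinnertonDyer.BirchSwinnertonDyer.Theorems.PrintCFramBottomClassIndexLawFiveLeFlipRungLowerUnipotentWeight
import Literature.NumberTheory.EllipticCurves.HalfIntegralWeightGaussSums
import HarnessLib

set_option autoImplicit false

/-!
# Crux `PrintCFram.BottomClassIndexLawFiveLe` (stmt-BirchSwinnertonDyer-20372), line `eisenstein-resource-bdp-line` (registry v29):
# T6 «THE 2-ADIC FLIPPED-CUSP RUNG», piece P4a — THE CONSTANT TERM OF `θ` AT AN ODD CUSP IS A UNIT OF `ℤ̄[1/N]`
# (cell `bsd-print-cfram`, width seat `bsd-line-cfram-p1-w5` g8; THEOREMS ONLY, `--supports` 20372; BSD is not proved by any of this)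

HONEST FRAMING. Finite character sums only; nothing here is a statement about elliptic curves, Bernoulli numbers or BSD; no registered
stub is closed. In w7 g8's architecture of the 2-adic rung (crux notes `…-w7g8-T6.md` v4 §5d, piece P4) the Katz vehicle at the flipped
cusp factors as `Θ̃ · B` with `Θ̃(w) = Σ_k e(16k²/M′)·G(a,k;M′)·e(16k²w)` read off the tree's `shimuraTheta_smul_eq_tsum`
(`θ` at the odd cusp `a/M′`); w3 g19's NF-Q transport `exists_isIntegral_qExpansion_coeff_of_slash_eq_mul` then needs the constant term
`G(a; M′) = quadGaussSum M′ a 0` to be a UNIT of `ℤ̄[1/N]`. This file supplies exactly that, prime-factorisation-free: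

* §1 **`quadGaussSum_mul_quadGaussSum_neg`**: for odd `M` and a unit `a mod M`, `G(a;M)·G(−a;M) = M` — the substitution
  `(r,s) ↦ (r−s, r+s)` (a bijection of `(ℤ/M)²` because `2` is invertible) turns `Σ_{r,s} ψ(a(r²−s²))` into `Σ_{u,v} ψ(auv) = M·#{u : au = 0} = M`
  (orthogonality of the primitive character `ZMod.stdAddChar`, Mathlib `AddChar.sum_mulShift`).
* §2 `isIntegral_quadGaussSum` (a sum of roots of unity; w3 g19's `isIntegral_stdAddChar`) and **`exists_inverse_quadGaussSum`**: for odd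
  `M ∣ N` and a unit `a`, `∃ v ∈ ℤ̄[1/N]` (spelled `∃ j, IsIntegral ℤ (N^j·v)` as in NF-Q) with `G(a;M)·v = 1`, namely `v = G(−a;M)/M` —
  the `hΘ0` hypothesis shape of `exists_isIntegral_qExpansion_coeff_of_slash_eq_mul`.
beyond-print theorem: NO.

References: [Shimura1973HalfIntegral] §1 (θ at the cusps); [IwaniecKowalski2004] §3.4 (quadratic Gauss sums, `|G(a;M)|² = M` for odd `M`);
crux notes w7g8-T6 v4 §5d (P4).
-/

-- summit-side namespace `Summit.BirchSwinnertonDyer.BirchSwinnertonDyer.…` (single-conjunct summit, D-0017 layout)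
set_option linter.dupNamespace false

noncomputable section

open scoped Real Classical
open Complex Finset
open Literature.NumberTheory.EllipticCurves.ModularForms

namespace Summit.BirchSwinnertonDyer.BirchSwinnertonDyer.Theorems.PrintCFram.FlipRung

/-! ## §1 `G(a;M)·G(−a;M) = M` for odd `M` and a unit `a` -/

/-- For odd `M`, `2` is a unit of `ℤ/M`: `2 · (M+1)/2 = 1`. [folklore] -/
theorem exists_two_mul_eq_one_of_odd {M : ℕ} [NeZero M] (hM : Odd M) : ∃ t : ZMod M, 2 * t = 1 := by
  obtain ⟨m, hm⟩ := hM
  refine ⟨((m + 1 : ℕ) : ZMod M), ?_⟩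
  have h : ((2 * (m + 1) : ℕ) : ZMod M) = ((M + 1 : ℕ) : ZMod M) := by rw [hm]; ring_nf
  have h2 : ((2 * (m + 1) : ℕ) : ZMod M) = 2 * ((m + 1 : ℕ) : ZMod M) := by push_cast; ring
  rw [← h2, h]
  push_cast
  rw [ZMod.natCast_self, zero_add]

/-- **`G(a;M)·G(−a;M) = M`** for odd `M ≥ 1` and a unit `a ∈ ℤ/M` (`G(a;M) = Σ_r e(ar²/M)`, the tree's `quadGaussSum M a 0`): the
substitution `(r,s) ↦ (u,v) = (r−s, r+s)` gives `Σ_{r,s} ψ(a r²)ψ(−a s²) = Σ_{u,v} ψ(a·u·v) = Σ_u M·[au = 0] = M`. Equivalently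
`|G(a;M)|² = M` (`G(−a;M) = conj G(a;M)`). [cite: IwaniecKowalski2004, §3.4] -/
theorem quadGaussSum_mul_quadGaussSum_neg {M : ℕ} [NeZero M] (hM : Odd M) {a : ZMod M} (ha : IsUnit a) :
    quadGaussSum M a 0 * quadGaussSum M (-a) 0 = M := by
  obtain ⟨t, ht⟩ := exists_two_mul_eq_one_of_odd hM
  -- the linear substitution `e (r, s) = (r − s, r + s)`, inverse `(u, v) ↦ (t(u+v), t(v−u))`
  let e : ZMod M × ZMod M ≃ ZMod M × ZMod M :=
    { toFun := fun p ↦ (p.1 - p.2, p.1 + p.2)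
      invFun := fun p ↦ (t * (p.1 + p.2), t * (p.2 - p.1))
      left_inv := fun p ↦ Prod.ext (by simp only; linear_combination p.1 * ht) (by simp only; linear_combination p.2 * ht)
      right_inv := fun p ↦ Prod.ext (by simp only; linear_combination p.1 * ht) (by simp only; linear_combination p.2 * ht) }
  have hψ := ZMod.isPrimitive_stdAddChar M
  calc quadGaussSum M a 0 * quadGaussSum M (-a) 0
      = ∑ p : ZMod M × ZMod M, (ZMod.stdAddChar (a * (p.1 ^ 2 - p.2 ^ 2)) : ℂ) := by
        rw [quadGaussSum_def, quadGaussSum_def, Finset.sum_mul_sum, ← Fintype.sum_prod_type']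
        refine Finset.sum_congr rfl fun p _ ↦ ?_
        rw [zero_mul, add_zero, zero_mul, add_zero, ← AddChar.map_add_eq_mul]
        congr 1
        ring
    _ = ∑ q : ZMod M × ZMod M, (ZMod.stdAddChar (q.2 * (a * q.1)) : ℂ) := by
        rw [← Equiv.sum_comp e.symm (fun p : ZMod M × ZMod M ↦ (ZMod.stdAddChar (a * (p.1 ^ 2 - p.2 ^ 2)) : ℂ))]
        refine Finset.sum_congr rfl fun q _ ↦ ?_
        congr 1
        show a * ((t * (q.1 + q.2)) ^ 2 - (t * (q.2 - q.1)) ^ 2) = q.2 * (a * q.1)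
        linear_combination (a * q.1 * q.2 * (2 * t + 1)) * ht
    _ = ∑ u : ZMod M, ∑ v : ZMod M, (ZMod.stdAddChar (v * (a * u)) : ℂ) := Fintype.sum_prod_type _
    _ = ∑ u : ZMod M, (((if a * u = 0 then Fintype.card (ZMod M) else 0 : ℕ)) : ℂ) := by
        refine Finset.sum_congr rfl fun u _ ↦ ?_
        rw [AddChar.sum_mulShift _ hψ]
    _ = M := by
        simp only [ha.mul_right_eq_zero, ZMod.card, Nat.cast_ite, Nat.cast_zero, Finset.sum_ite_eq', Finset.mem_univ,
          if_true]

/-! ## §2 Integrality and the inverse in `ℤ̄[1/N]` -/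

/-- `G(a, k; M)` is an algebraic integer (a sum of roots of unity). [folklore] -/
theorem isIntegral_quadGaussSum {M : ℕ} [NeZero M] (a k : ZMod M) : IsIntegral ℤ (quadGaussSum M a k) := by
  rw [quadGaussSum_def]
  exact IsIntegral.sum _ fun r _ ↦ isIntegral_stdAddChar _

/-- **THE CONSTANT TERM OF `θ` AT AN ODD CUSP IS A UNIT OF `ℤ̄[1/N]`.** For odd `M` with `M ∣ N` and a unit `a ∈ ℤ/M`, there is
`v` with `N^j·v` an algebraic integer for some `j` (i.e. `v ∈ ℤ̄[1/N]`, the NF-Q currency) and `G(a;M)·v = 1`, namely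
`v = G(−a;M)·M⁻¹` — the `hΘ0` hypothesis of w3 g19's transport `exists_isIntegral_qExpansion_coeff_of_slash_eq_mul` for the factor `Θ̃`
of the 2-adic vehicle at the flipped cusp (`shimuraTheta_smul_eq_tsum`, constant term `G(a; M′)`). [cite: IwaniecKowalski2004, §3.4] -/
theorem exists_inverse_quadGaussSum {M N : ℕ} [NeZero M] (hM : Odd M) (hMN : M ∣ N) {a : ZMod M} (ha : IsUnit a) :
    ∃ v : ℂ, (∃ j : ℕ, IsIntegral ℤ ((N : ℂ) ^ j * v)) ∧ quadGaussSum M a 0 * v = 1 := by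
  have hM0 : (M : ℂ) ≠ 0 := by exact_mod_cast NeZero.ne M
  refine ⟨quadGaussSum M (-a) 0 * (M : ℂ)⁻¹, ?_, ?_⟩
  · exact exists_isIntegral_pow_mul_mul (exists_isIntegral_pow_mul_of_isIntegral (isIntegral_quadGaussSum _ _))
      (exists_isIntegral_pow_mul_inv_of_dvd (NeZero.ne M) hMN)
  · rw [← mul_assoc, quadGaussSum_mul_quadGaussSum_neg hM ha, mul_inv_cancel₀ hM0]

/-- The unit-argument case that occurs at the cusp `[a b; M 64]`: `gcd(a, M) = 1` from the determinant `64a − bM = 1`, so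
`G(a;M)·G(−a;M) = M` and `G(a;M)` is a unit of `ℤ̄[1/N]` for odd `M ∣ N`. [cite: IwaniecKowalski2004, §3.4] -/
theorem exists_inverse_quadGaussSum_of_det {M N : ℕ} [NeZero M] (hM : Odd M) (hMN : M ∣ N) {a b : ℤ}
    (hdet : a * 64 - b * M = 1) :
    ∃ v : ℂ, (∃ j : ℕ, IsIntegral ℤ ((N : ℂ) ^ j * v)) ∧ quadGaussSum M a 0 * v = 1 := by
  have ha : IsUnit ((a : ℤ) : ZMod M) := by
    have h : ((a : ℤ) : ZMod M) * ((64 : ℤ) : ZMod M) = 1 := by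
      have := congrArg (fun z : ℤ ↦ (z : ZMod M)) hdet
      simp only [Int.cast_sub, Int.cast_mul, Int.cast_one, Int.cast_natCast, ZMod.natCast_self, mul_zero, sub_zero] at this
      exact this
    exact IsUnit.of_mul_eq_one _ h
  exact exists_inverse_quadGaussSum hM hMN ha

end Summit.BirchSwinnertonDyer.BirchSwinnertonDyer.Theorems.PrintCFram.FlipRung

end
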